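import Summits.NavierStokesRegularity.NavierStokesRegularity.Theses.ExtremalTypeIConstant
import Summits.NavierStokesRegularity.NavierStokesRegularity.Theorems.SymmetryModuliCountSymmetricLiouville
import Summits.NavierStokesRegularity.NavierStokesRegularity.Theorems.SymmetryModuliCountSymmetricLiouvilleSelfSimilarLeaf
import Literature.Analysis.FluidPDE.TypeIAncientMild
import HarnessLib

/-!
# Route `ExtremalTypeIConstant`, support item `SelfSimilarExcluded` (stmt-NavierStokesRegularity-8219)

The `A = 0` case of the route's crux `SpiralScalingLiouville`: an element `u` of the Type-I
KNSS-mild ancient class `A_C` on `ℝ³` (jointly smooth on `t < 0`, divergence free, Oseen-mild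
between all pairs of negative times, `‖u(t,x)‖ ≤ C/√(−t)`) which is exactly backward self-similar
about some point `(x₁, 0)`, `x₁ = −a` — annihilated by the scaling generator centred at `−a`,
`D(u t)(x)(a + x) + u t x + 2t ∂ₜu(t, x) = 0` on `t < 0` — vanishes identically on `t < 0`.

## Proof

Translate the centre to the origin: `v t y := u t (y − a)` is again in `A_C`
(`isTypeIAncientMild_comp_add_right`: the class is invariant under space translations, KNSS 2009
§1) and is annihilated by the scaling generator about the space–time origin,
`D(v t)(y) y + v t y + 2t ∂ₜv(t, y) = 0` (chain rule, `fderiv_comp_add_right`). The landed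
self-similar leaf of route `SymmetryModuliCount`
(`SymmetryModuliCountSymmetricLiouville.stub_selfSimilarLeaf`: integrate the clause to
`v = (−t)^{-1/2} U(·/√(−t))`, KNSS pressure + Leray's reduction make `(U, Q)` a bounded Leray
profile, Tsai 1998 Thm 1 at `q = ∞` makes `U` constant, and the Oseen gauge kills constants
`b/√(−t)`, KNSS 2009 Remark 6.1) gives `v ≡ 0`, hence `u ≡ 0`.

No new definitions, no named facts.

## References

* T.-P. Tsai, Arch. Rational Mech. Anal. 143 (1998) 29–51, Theorem 1 (`q = ∞`). [Tsai1998]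
* J. Nečas, M. Růžička, V. Šverák, Acta Math. 176 (1996) 283–294. [NecasRuzickaSverak1996]
* G. Koch, N. Nadirashvili, G. Seregin, V. Šverák, Acta Math. 203 (2009) 83–105
  = arXiv:0709.3599, §1 p. 3 (symmetries of the class), Remark 6.1. [KochNadirashviliSereginSverak2009]
-/

noncomputable section

-- the summit and its single sub-problem share the name (CONVENTIONS §1), as in every Theorems file
set_option linter.dupNamespace false

namespace Summit.NavierStokesRegularity.NavierStokesRegularity.Theorems

open Set Function
open Literature.Analysis.FluidPDE
open Summit.NavierStokesRegularity.NavierStokesRegularity.Theses.ExtremalTypeIConstant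
open Summit.NavierStokesRegularity.NavierStokesRegularity.Theorems.SymmetryModuliCountSymmetricLiouville

/-- **Translating the centre of a self-similar element of `A_C` to the origin.** If `u ∈ A_C` is
annihilated by the scaling generator centred at `−a`, `D(u t)(x)(a + x) + u t x + 2t ∂ₜu = 0` on
`t < 0`, then the translate `v t y = u t (y + (−a))` is annihilated by the scaling generator about
the origin, `D(v t)(y) y + v t y + 2t ∂ₜv = 0` (chain rule `fderiv_comp_add_right`; the time
derivative commutes with space translation definitionally). [folklore] -/
theorem extremalTypeIConstant_selfSimilarExcluded_generator_translate
    {u : ℝ → EuclideanSpace ℝ (Fin 3) → EuclideanSpace ℝ (Fin 3)} {a : EuclideanSpace ℝ (Fin 3)}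
    (hL : ∀ t < 0, ∀ x, fderiv ℝ (u t) x (a + x) + u t x + (2 * t) • timeDeriv u t x = 0) :
    ∀ t < 0, ∀ x, fderiv ℝ (fun y => u t (y + -a)) x x + u t (x + -a)
      + (2 * t) • timeDeriv (fun s y => u s (y + -a)) t x = 0 := by
  intro t ht x
  have key := hL t ht (x + -a)
  have e1 : a + (x + -a) = x := by abel
  rw [e1] at key
  have e2 : fderiv ℝ (fun y => u t (y + -a)) x = fderiv ℝ (u t) (x + -a) := by
    rw [fderiv_comp_add_right]
  have e3 : timeDeriv (fun s y => u s (y + -a)) t x = timeDeriv u t (x + -a) := rfl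
  rw [e2, e3]
  exact key

/-- **The route item `SelfSimilarExcluded` (stmt-NavierStokesRegularity-8219, support of route
`ExtremalTypeIConstant`) BY NAME.** An element of the Type-I KNSS-mild ancient class `A_C` on `ℝ³`
that is exactly backward self-similar about some `(x₁, 0)` (generator
`∇u·(a + x) + u + 2t∂ₜu = 0`, `x₁ = −a`) vanishes identically on `t < 0`: translate the centre to
the origin (`isTypeIAncientMild_comp_add_right`, the class is translation invariant) and apply the
landed self-similar leaf `stub_selfSimilarLeaf` of route `SymmetryModuliCount` (Tsai 1998, Thm 1,
`q = ∞`, in the Oseen gauge; KNSS 2009 Remark 6.1 kills the constant). [cite: Tsai1998, Thm 1 (p. 31)] -/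
theorem extremalTypeIConstant_selfSimilarExcluded_proof : SelfSimilarExcluded := by
  unfold SelfSimilarExcluded
  intro C u hu hgen t ht x
  obtain ⟨a, hL⟩ := hgen
  have hcl : IsTypeIAncientMild C u := isTypeIAncientMild_iff.2 hu
  -- translate the centre `-a` to the origin
  have hv : IsTypeIAncientMild C (fun s y => u s (y + -a)) := isTypeIAncientMild_comp_add_right hcl (-a)
  have hLv := extremalTypeIConstant_selfSimilarExcluded_generator_translate hL
  -- the self-similar leaf on the translated field, then translate back
  have hzero : ∀ s < 0, ∀ y, (fun s y => u s (y + -a)) s y = 0 :=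
    stub_selfSimilarLeaf C (fun s y => u s (y + -a)) hv hLv
  have key := hzero t ht (x - -a)
  simpa only [sub_add_cancel] using key

end Summit.NavierStokesRegularity.NavierStokesRegularity.Theorems

end
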